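import Mathlib
import Summits.PneNP.PneNP.Theorems.SymmetryBudgetHamCompilesDefs

/-!
# Reduced echelon rows over `GF(2)` (stub `stub_rref` of line `kotzig-cutspan`, clause 1)

Route `PneNP/SymmetryBudget`, crux `Summit.PneNP.PneNP.Theses.SymmetryBudget.HamCompiles`
(stmt-PneNP-10637), line `kotzig-cutspan`, stub `stub_rref`. This file is the reusable theory of
the CHOICE-FREE reduced echelon table `rrefBit` / `rrefRow` of a subspace
`W ≤ GF(2)^(Fin g → Bool)` with respect to the coordinate order `skey` (the binary number of a
coordinate, injective: `skey_injective`):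

* `lead_spec`, `lead_eq`: the leading (lowest-`skey` nonzero) coordinate of a nonzero vector;
  `isPivot_lead`: it is a pivot of every subspace containing the vector;
  `eq_zero_of_forall_isPivot`: a vector of `W` vanishing at every pivot of `W` is `0`;
* `existsUnique_rrefRow`: at a pivot `c` there is exactly one REDUCED ROW (`w ∈ W`, `w c = 1`,
  `w` zero below `c` and at every other pivot); `rrefRow W c` is that row (`rrefRow_spec`,
  `rrefRow_mem`, `rrefRow_apply_self`, `rrefRow_apply_of_lt`, `rrefRow_apply_pivot_ne`) and
  `rrefRow W c = 0` at a non-pivot (`rrefRow_of_not_isPivot`); `rrefRow_eq_of` characterises the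
  whole table;
* `reduceBy_rrefRow_apply_pivot`: reduction by the table clears the pivot coordinates;
  `mem_iff_sum_rrefRow`, `span_range_rrefRow` (clause 1 of `stub_rref`; closed form
  `stub_rref_rows`, the deciding theorem of this helper file): the rows span `W`.

Clause 2 (`insertRow` computes the table of `U ⊔ span {v}`), clause 3 (injectivity of the
stars-and-bars code `sbCode`) and `stub_rref` itself are in
`SymmetryBudgetHamCompilesStubRref.lean`, which imports this file.
-/

-- `Summit.PneNP.PneNP.…` duplicates `PneNP` BY DESIGN (single-problem summit, D-0017).
set_option linter.dupNamespace false

noncomputable section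

namespace Summit.PneNP.PneNP.Theorems.HamCompilesKC

open Finset

section Echelon

variable {g : ℕ}

/-! ### Arithmetic of `ZMod 2` -/

/-- Every element of `ZMod 2` is `0` or `1`. -/
theorem zmod2_eq_zero_or_one (a : ZMod 2) : a = 0 ∨ a = 1 := by
  revert a; decide

/-- In `ZMod 2`, nonzero means `1`. -/
theorem zmod2_ne_zero_iff (a : ZMod 2) : a ≠ 0 ↔ a = 1 := by
  revert a; decide

/-- In `ZMod 2`, `a + a = 0`. -/
theorem zmod2_add_self (a : ZMod 2) : a + a = 0 := by
  revert a; decide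

/-- In `ZMod 2`, `a + b = 0` forces `a = b`. -/
theorem zmod2_eq_of_add_eq_zero (a b : ZMod 2) (h : a + b = 0) : a = b := by
  revert a b; decide

/-! ### The coordinate order `skey` -/

/-- `skey S` is the binary number `∑_{i ∈ S} 2^i`. -/
theorem skey_eq_sum (S : Fin g → Bool) :
    skey S = ∑ n ∈ (univ.filter fun i : Fin g => S i = true).map Fin.valEmbedding, 2 ^ n := by
  rw [Finset.sum_map, Finset.sum_filter]
  rfl

/-- The coordinate order is a genuine linear order: `skey` is injective. -/
theorem skey_injective : Function.Injective (skey (g := g)) := by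
  intro S₁ S₂ h
  rw [skey_eq_sum, skey_eq_sum] at h
  have h1 := Finset.geomSum_injective (n := 2) le_rfl h
  rw [Finset.map_inj] at h1
  funext i
  have h2 := congrArg (i ∈ ·) h1
  simp only [Finset.mem_filter, Finset.mem_univ, true_and, eq_iff_iff] at h2
  exact Bool.eq_iff_iff.2 h2

/-- Two coordinates at which the same vector "leads" (is nonzero, and zero strictly below)
coincide. -/
theorem eq_of_leads {w : Vec g} {c₁ c₂ : Fin g → Bool}
    (h₁ : w c₁ ≠ 0) (h₁' : ∀ c', skey c' < skey c₁ → w c' = 0)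
    (h₂ : w c₂ ≠ 0) (h₂' : ∀ c', skey c' < skey c₂ → w c' = 0) : c₁ = c₂ := by
  apply skey_injective
  by_contra hne
  rcases lt_or_gt_of_ne hne with h | h
  · exact h₁ (h₂' c₁ h)
  · exact h₂ (h₁' c₂ h)

/-! ### The leading coordinate -/

/-- **Specification of `lead`.** A nonzero vector is nonzero at its leading coordinate and
vanishes at every `skey`-smaller coordinate. -/
theorem lead_spec {v : Vec g} (hv : v ≠ 0) :
    v (lead v) ≠ 0 ∧ ∀ c', skey c' < skey (lead v) → v c' = 0 := by
  have h : ∃ c, v c ≠ 0 ∧ ∀ c', skey c' < skey c → v c' = 0 := by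
    obtain ⟨c₀, hc₀⟩ := Function.ne_iff.1 hv
    obtain ⟨c, hc, hmin⟩ := Finset.exists_min_image (univ.filter fun c => v c ≠ 0) skey
      ⟨c₀, by simpa using hc₀⟩
    refine ⟨c, (Finset.mem_filter.1 hc).2, fun c' hc' => ?_⟩
    by_contra hne
    exact absurd (hmin c' (by simpa using hne)) (not_le.2 hc')
  unfold lead
  rw [dif_pos h]
  exact Classical.choose_spec h

/-- `lead v` is THE coordinate at which `v` leads. -/
theorem lead_eq {v : Vec g} {c : Fin g → Bool} (hc : v c ≠ 0)
    (hlt : ∀ c', skey c' < skey c → v c' = 0) : lead v = c := by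
  have hv : v ≠ 0 := fun h => hc (by simp [h])
  exact eq_of_leads (lead_spec hv).1 (lead_spec hv).2 hc hlt

/-! ### Pivots -/

/-- Pivots are monotone in the subspace. -/
theorem isPivot_mono {U U' : Submodule (ZMod 2) (Vec g)} (h : U ≤ U') {c : Fin g → Bool}
    (hc : IsPivot U c) : IsPivot U' c := by
  obtain ⟨w, hw, h1, h2⟩ := hc
  exact ⟨w, h hw, h1, h2⟩

/-- The leading coordinate of a nonzero vector of `W` is a pivot of `W`. -/
theorem isPivot_lead {W : Submodule (ZMod 2) (Vec g)} {w : Vec g} (hw : w ∈ W) (hw0 : w ≠ 0) :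
    IsPivot W (lead w) :=
  ⟨w, hw, (zmod2_ne_zero_iff _).1 (lead_spec hw0).1, (lead_spec hw0).2⟩

/-- A vector of `W` vanishing at every pivot of `W` is zero. -/
theorem eq_zero_of_forall_isPivot {W : Submodule (ZMod 2) (Vec g)} {u : Vec g} (hu : u ∈ W)
    (h : ∀ p, IsPivot W p → u p = 0) : u = 0 := by
  by_contra hne
  exact (lead_spec hne).1 (h _ (isPivot_lead hu hne))

/-! ### Reduced rows: existence and uniqueness -/

/-- **Existence of the reduced row** at a pivot `c`: some `w ∈ W` has `w c = 1`, vanishes below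
`c` and at every other pivot (kill the entries at the other pivots in increasing `skey` order). -/
theorem exists_reducedRow (W : Submodule (ZMod 2) (Vec g)) {c : Fin g → Bool} (hc : IsPivot W c) :
    ∃ w ∈ W, w c = 1 ∧ (∀ c'', skey c'' < skey c → w c'' = 0) ∧
      ∀ p, IsPivot W p → p ≠ c → w p = 0 := by
  have key : ∀ k : ℕ, ∃ w ∈ W, w c = 1 ∧ (∀ c'', skey c'' < skey c → w c'' = 0) ∧
      ∀ p, IsPivot W p → p ≠ c → skey p < k → w p = 0 := by
    intro k
    induction k with
    | zero =>
      obtain ⟨w, hwW, hwc, hwlt⟩ := hc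
      exact ⟨w, hwW, hwc, hwlt, fun p _ _ h => absurd h (Nat.not_lt_zero _)⟩
    | succ k ih =>
      obtain ⟨w, hwW, hwc, hwlt, hwp⟩ := ih
      by_cases hex : ∃ p, IsPivot W p ∧ p ≠ c ∧ skey p = k ∧ w p ≠ 0
      · obtain ⟨p, hp, hpc, hpk, hwp0⟩ := hex
        obtain ⟨wp, hwpW, hwpp, hwplt⟩ := hp
        have hcp : skey c < skey p := by
          rcases lt_trichotomy (skey c) (skey p) with h | h | h
          · exact h
          · exact absurd (skey_injective h).symm hpc
          · exact absurd (hwlt p h) hwp0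
        refine ⟨w + wp, W.add_mem hwW hwpW, ?_, ?_, ?_⟩
        · simp [hwc, hwplt c hcp]
        · intro c'' hc''
          simp [hwlt c'' hc'', hwplt c'' (hc''.trans hcp)]
        · intro p' hp' hp'c hp'k
          rcases Nat.lt_succ_iff_lt_or_eq.1 hp'k with hlt | heq
          · simp [hwp p' hp' hp'c hlt, hwplt p' (hpk ▸ hlt)]
          · have hpp : p' = p := skey_injective (heq.trans hpk.symm)
            subst hpp
            rw [Pi.add_apply, hwpp, (zmod2_ne_zero_iff _).1 hwp0]
            exact zmod2_add_self 1
      · refine ⟨w, hwW, hwc, hwlt, ?_⟩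
        intro p' hp' hp'c hp'k
        rcases Nat.lt_succ_iff_lt_or_eq.1 hp'k with hlt | heq
        · exact hwp p' hp' hp'c hlt
        · by_contra hne
          exact hex ⟨p', hp', hp'c, heq, hne⟩
  obtain ⟨w, hwW, hwc, hwlt, hwp⟩ := key ((univ : Finset (Fin g → Bool)).sup skey + 1)
  exact ⟨w, hwW, hwc, hwlt, fun p hp hpc =>
    hwp p hp hpc (Nat.lt_succ_of_le (Finset.le_sup (f := skey) (Finset.mem_univ p)))⟩

/-- **Uniqueness of the reduced row**: two reduced rows at the same pivot coincide (their
difference lies in `W` and vanishes at every pivot). -/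
theorem reducedRow_unique {W : Submodule (ZMod 2) (Vec g)} {c : Fin g → Bool} {w₁ w₂ : Vec g}
    (h₁ : w₁ ∈ W ∧ w₁ c = 1 ∧ (∀ c'', skey c'' < skey c → w₁ c'' = 0) ∧
      ∀ p, IsPivot W p → p ≠ c → w₁ p = 0)
    (h₂ : w₂ ∈ W ∧ w₂ c = 1 ∧ (∀ c'', skey c'' < skey c → w₂ c'' = 0) ∧
      ∀ p, IsPivot W p → p ≠ c → w₂ p = 0) : w₁ = w₂ := by
  rw [← sub_eq_zero]
  apply eq_zero_of_forall_isPivot (W.sub_mem h₁.1 h₂.1)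
  intro p hp
  by_cases hpc : p = c
  · subst hpc
    simp [h₁.2.1, h₂.2.1]
  · simp [h₁.2.2.2 p hp hpc, h₂.2.2.2 p hp hpc]

/-- At a pivot with reduced row `w`, the echelon bit `(c, c')` is `[w c' = 1]`. -/
theorem rrefBit_iff {W : Submodule (ZMod 2) (Vec g)} {c : Fin g → Bool} {w : Vec g}
    (hw : w ∈ W ∧ w c = 1 ∧ (∀ c'', skey c'' < skey c → w c'' = 0) ∧
      ∀ p, IsPivot W p → p ≠ c → w p = 0) (c' : Fin g → Bool) :
    rrefBit W c c' ↔ w c' = 1 := by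
  constructor
  · rintro ⟨w', hw'W, hw'c, hw'lt, hw'p, hw'c'⟩
    rw [reducedRow_unique hw ⟨hw'W, hw'c, hw'lt, hw'p⟩]
    exact hw'c'
  · intro h
    exact ⟨w, hw.1, hw.2.1, hw.2.2.1, hw.2.2.2, h⟩

/-- An echelon bit in row `c` forces `c` to be a pivot. -/
theorem isPivot_of_rrefBit {W : Submodule (ZMod 2) (Vec g)} {c c' : Fin g → Bool}
    (h : rrefBit W c c') : IsPivot W c := by
  obtain ⟨w, hwW, hwc, hwlt, -, -⟩ := h
  exact ⟨w, hwW, hwc, hwlt⟩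

/-- `rrefRow W c` IS the reduced row at `c` (as a vector), whenever one is given. -/
theorem rrefRow_eq_of_row {W : Submodule (ZMod 2) (Vec g)} {c : Fin g → Bool} {w : Vec g}
    (hw : w ∈ W ∧ w c = 1 ∧ (∀ c'', skey c'' < skey c → w c'' = 0) ∧
      ∀ p, IsPivot W p → p ≠ c → w p = 0) : rrefRow W c = w := by
  funext c'
  unfold rrefRow
  by_cases hb : rrefBit W c c'
  · rw [if_pos hb]
    exact ((rrefBit_iff hw c').1 hb).symm
  · rw [if_neg hb]
    have h1 : w c' ≠ 1 := fun h => hb ((rrefBit_iff hw c').2 h)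
    rcases zmod2_eq_zero_or_one (w c') with h | h
    · exact h.symm
    · exact absurd h h1

/-- The row of a non-pivot is zero. -/
theorem rrefRow_of_not_isPivot {W : Submodule (ZMod 2) (Vec g)} {c : Fin g → Bool}
    (hc : ¬ IsPivot W c) : rrefRow W c = 0 := by
  funext c'
  unfold rrefRow
  rw [if_neg fun h => hc (isPivot_of_rrefBit h)]
  rfl

/-- **The pivot row.** At a pivot `c`, `rrefRow W c` lies in `W`, has a `1` at `c`, and vanishes
below `c` and at every other pivot. -/
theorem rrefRow_spec {W : Submodule (ZMod 2) (Vec g)} {c : Fin g → Bool} (hc : IsPivot W c) :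
    rrefRow W c ∈ W ∧ rrefRow W c c = 1 ∧ (∀ c'', skey c'' < skey c → rrefRow W c c'' = 0) ∧
      ∀ p, IsPivot W p → p ≠ c → rrefRow W c p = 0 := by
  obtain ⟨w, hwW, hwc, hwlt, hwp⟩ := exists_reducedRow W hc
  rw [rrefRow_eq_of_row ⟨hwW, hwc, hwlt, hwp⟩]
  exact ⟨hwW, hwc, hwlt, hwp⟩

/-- **Exactly one reduced row at every pivot** (namely `rrefRow W c`). -/
theorem existsUnique_rrefRow {W : Submodule (ZMod 2) (Vec g)} {c : Fin g → Bool}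
    (hc : IsPivot W c) :
    ∃! w : Vec g, w ∈ W ∧ w c = 1 ∧ (∀ c'', skey c'' < skey c → w c'' = 0) ∧
      ∀ p, IsPivot W p → p ≠ c → w p = 0 :=
  ⟨rrefRow W c, rrefRow_spec hc, fun _ hw => (rrefRow_eq_of_row hw).symm⟩

/-- Every row of the table lies in `W`. -/
theorem rrefRow_mem (W : Submodule (ZMod 2) (Vec g)) (c : Fin g → Bool) : rrefRow W c ∈ W := by
  by_cases hc : IsPivot W c
  · exact (rrefRow_spec hc).1
  · rw [rrefRow_of_not_isPivot hc]
    exact W.zero_mem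

/-- A pivot row has a `1` on the diagonal. -/
theorem rrefRow_apply_self {W : Submodule (ZMod 2) (Vec g)} {c : Fin g → Bool}
    (hc : IsPivot W c) : rrefRow W c c = 1 :=
  (rrefRow_spec hc).2.1

/-- Row `c` vanishes strictly below `c`. -/
theorem rrefRow_apply_of_lt (W : Submodule (ZMod 2) (Vec g)) {c c'' : Fin g → Bool}
    (h : skey c'' < skey c) : rrefRow W c c'' = 0 := by
  by_cases hc : IsPivot W c
  · exact (rrefRow_spec hc).2.2.1 c'' h
  · rw [rrefRow_of_not_isPivot hc]
    rfl

/-- Row `c` vanishes at every pivot other than `c`. -/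
theorem rrefRow_apply_pivot_ne {W : Submodule (ZMod 2) (Vec g)} (c : Fin g → Bool)
    {p : Fin g → Bool} (hp : IsPivot W p) (hpc : p ≠ c) : rrefRow W c p = 0 := by
  by_cases hc : IsPivot W c
  · exact (rrefRow_spec hc).2.2.2 p hp hpc
  · rw [rrefRow_of_not_isPivot hc]
    rfl

/-- The pivot columns of the table are unit columns. -/
theorem rrefRow_apply_pivot {W : Submodule (ZMod 2) (Vec g)} (c : Fin g → Bool)
    {p : Fin g → Bool} (hp : IsPivot W p) : rrefRow W c p = if c = p then 1 else 0 := by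
  by_cases hcp : c = p
  · subst hcp
    rw [if_pos rfl]
    exact rrefRow_apply_self hp
  · rw [if_neg hcp]
    exact rrefRow_apply_pivot_ne c hp (Ne.symm hcp)

/-- **Characterisation of the whole table.** A family of rows with the defining properties of
the reduced echelon table IS the table. -/
theorem rrefRow_eq_of {W : Submodule (ZMod 2) (Vec g)} {R : (Fin g → Bool) → Vec g}
    (hpiv : ∀ c, IsPivot W c → R c ∈ W ∧ R c c = 1 ∧ (∀ c'', skey c'' < skey c → R c c'' = 0) ∧
      ∀ p, IsPivot W p → p ≠ c → R c p = 0)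
    (hzero : ∀ c, ¬ IsPivot W c → R c = 0) : R = rrefRow W := by
  funext c
  by_cases hc : IsPivot W c
  · exact (rrefRow_eq_of_row (hpiv c hc)).symm
  · rw [hzero c hc, rrefRow_of_not_isPivot hc]

/-! ### Reduction by the table; the rows span -/

/-- Coordinates of a reduced vector. -/
theorem reduceBy_apply (R : (Fin g → Bool) → Vec g) (v : Vec g) (c' : Fin g → Bool) :
    reduceBy R v c' = v c' + ∑ c, v c * R c c' := by
  simp [reduceBy, Finset.sum_apply]

/-- Reduction by the table of `W` clears every pivot coordinate of `W`. -/
theorem reduceBy_rrefRow_apply_pivot {W : Submodule (ZMod 2) (Vec g)} (v : Vec g)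
    {p : Fin g → Bool} (hp : IsPivot W p) : reduceBy (rrefRow W) v p = 0 := by
  rw [reduceBy_apply]
  have hsum : ∑ c, v c * rrefRow W c p = v p := by
    rw [Finset.sum_eq_single p]
    · rw [rrefRow_apply_self hp, mul_one]
    · intro c _ hcp
      rw [rrefRow_apply_pivot_ne c hp (Ne.symm hcp), mul_zero]
    · intro h
      exact absurd (Finset.mem_univ p) h
  rw [hsum]
  exact zmod2_add_self _

/-- The combination `∑_c v_c • (row c)` lies in `W`. -/
theorem sum_smul_rrefRow_mem (W : Submodule (ZMod 2) (Vec g)) (v : Vec g) :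
    ∑ c, v c • rrefRow W c ∈ W :=
  Submodule.sum_mem _ fun c _ => W.smul_mem _ (rrefRow_mem W c)

/-- Reducing a vector of `W` by the table of `W` stays in `W`. -/
theorem reduceBy_rrefRow_mem {W : Submodule (ZMod 2) (Vec g)} {v : Vec g} (hv : v ∈ W) :
    reduceBy (rrefRow W) v ∈ W :=
  W.add_mem hv (sum_smul_rrefRow_mem W v)

/-- **Row expansion.** `v ∈ W` iff `v` is the combination of the rows with its own pivot
coordinates as coefficients. -/
theorem mem_iff_sum_rrefRow (W : Submodule (ZMod 2) (Vec g)) (v : Vec g) :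
    v ∈ W ↔ v = ∑ c, v c • rrefRow W c := by
  constructor
  · intro hv
    have h0 : reduceBy (rrefRow W) v = 0 :=
      eq_zero_of_forall_isPivot (reduceBy_rrefRow_mem hv)
        fun p hp => reduceBy_rrefRow_apply_pivot v hp
    funext c
    exact zmod2_eq_of_add_eq_zero _ _ (congrFun h0 c)
  · intro h
    rw [h]
    exact sum_smul_rrefRow_mem W v

/-- **Clause 1 of `stub_rref`: the rows of the reduced echelon table span `W`.** -/
theorem span_range_rrefRow (W : Submodule (ZMod 2) (Vec g)) :
    Submodule.span (ZMod 2) (Set.range (rrefRow W)) = W := by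
  apply le_antisymm
  · rw [Submodule.span_le]
    rintro _ ⟨c, rfl⟩
    exact rrefRow_mem W c
  · intro v hv
    rw [(mem_iff_sum_rrefRow W v).1 hv]
    exact Submodule.sum_mem _ fun c _ =>
      Submodule.smul_mem _ _ (Submodule.subset_span ⟨c, rfl⟩)

end Echelon

/-- **Clause 1 of `stub_rref` in closed form** (the deciding theorem of this helper file): for
every `g` and every subspace `W ≤ GF(2)^(Fin g → Bool)`, the rows of `rrefRow W` span `W`. -/
theorem stub_rref_rows :
    ∀ (g : ℕ) (W : Submodule (ZMod 2) (Vec g)),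
      Submodule.span (ZMod 2) (Set.range (rrefRow W)) = W :=
  fun _ W => span_range_rrefRow W

end Summit.PneNP.PneNP.Theorems.HamCompilesKC
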